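import Literature.Analysis.InnerProduct.LensSpaceHeatTraceExpansion
import Mathlib.Analysis.Analytic.OfScalars
import HarnessLib

/-!
# Ikeda–Yamamoto's generating function of a three-dimensional lens space as a FUNCTION on the unit disc:
# `F(z) = ∑_k dim E_{k(k+2)}·z^k = (1/q)∑_{l=0}^{q−1}(1 − z²)/((1 − γ^{p₁l}z)(1 − γ^{−p₁l}z)(1 − γ^{p₂l}z)(1 − γ^{−p₂l}z))` (Theorem 3.2),
# meromorphic with poles only at `q`-th roots of unity, `lim_{z→1}(1−z)³F(z) = 2/q` (3.11), Proposition 3.1 (isospectral iff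
# `F = E`) and Corollary 3.3 (isospectral three-dimensional lens spaces have the same `q`) (Ikeda–Yamamoto 1979 §3)

Layer `Literature/Analysis/InnerProduct`, namespace `Literature.Analysis.InnerProduct`; lane `lit-hodgefound` (Track 2 foundations
library), prover seat `lit-hodgefound-p06`, generation 43, self-proposed row g43-#4 — the sequel BY IMPORT of rows g43-#2
(`LensSpaceMultiplicity.lean`: `lensMultiplicity q p₁ p₂ k = dim E_{k(k+2)}(L(q;p₁,p₂))`; `LensSpaceSpectrum.lean`: the multiplicity
formula (3.10) `lensMultiplicity_eq_sum_threeSphereHarmonicCharacter` and Theorem 3.2 COEFFICIENTWISE in `ℝ⟦X⟧`,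
`quadratic_mul_quadratic_mul_mk_threeSphereHarmonicCharacter`) and g43-#3 (`LensSpaceHeatTraceExpansion.lean`: the bound
`|χ̃_k(cos φ₁, cos φ₂)| ≤ 2(k+1)³` and `two_pi_mul_div_ne_of_isCoprime`). THIS file proves Theorem 3.2 AS PRINTED — an identity of
holomorphic functions on `{|z| < 1}` — and its printed consequences (3.11), Proposition 3.1, Corollary 3.3. THEOREMS ONLY (no
definition, no instance, no notation, no named fact). Mathlib supplies the Cauchy product of absolutely convergent series
(`tsum_mul_tsum_eq_tsum_sum_antidiagonal_of_summable_norm`), `Polynomial ↪ PowerSeries`, and the uniqueness of Taylor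
coefficients (`HasFPowerSeriesAt.eq_formalMultilinearSeries` with `FormalMultilinearSeries.ofScalars`).

## Source, verbatim (held text `paper:doi-10-18910-4811`, pp. 452–453)

A. Ikeda, Y. Yamamoto, *On the spectra of 3-dimensional lens spaces*, Osaka J. Math. **16** (1979) 447–469: "Now, we consider the
generating function `F(z)` associated to the infinite series `{dim E_{k(k+2n)}}_{k=0}^{∞}`, i.e., (3.6) `F(z) = ∑_{k=0}^{∞}(dim
E_{k(k+2n)})z^k`. By Corollary 1.4, the generating function `F(z)` determines the spectrum of `L(q : p₀, ⋯, p_n)`, so that we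
shall call the function `F(z)` the generating function associated to the spectrum of `L(q : p₀, ⋯, p_n)`. Now, consider another
lens space `L(q' : p'₀, ⋯, p'_n)` and denote by `E(z)` the generating function associated to the spectrum of `L(q' : p'₀, ⋯,
p'_n)`. Then we have **Proposition 3.1.** The lens space `L(q : p₀, ⋯, p_n)` is isospectral to `L(q' : p'₀, ⋯, p'_n)` if and only
if (3.7) `F(z) = E(z)`. **Theorem 3.2.** Let `L(q : p₀, ⋯, p_n)` be a lens space and `F(z)` the generating function associated
to the spectrum of `L(q : p₀, ⋯, p_n)`. Then `F(z)` has the following form on the domain `{z ∈ ℂ : |z| < 1}`: (3.8) `F(z) =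
(1/q)∑_{l=0}^{q−1}(1 − z²)/∏_{i=0}^{n}(1 − γ^{pᵢl}z)(1 − γ^{−pᵢl}z)`." (p0007); "`F(z)` can be considered as a meromorphic function on
the whole complex plane `ℂ`. Any pole of `F(z)` is an `q`-th root of one. Especially, `F(z)` has a pole of order `(2n+1)` at
`z = 1`, and (3.11) `lim_{z→1}(1−z)^{2n+1}F(z) = 2/q`. Thus, we have proved **Corollary 3.3.** Assume `L(q : p₀, ⋯, p_n)` is
isospectral to `L(q' : p'₀, ⋯, p'_n)`. Then we have `q = q'`." (p0008). Here `n + 1 = 2`, `γ = e^{2πi/q}`, `γ^{±pᵢl} = e^{±2πi·lpᵢ/q}`,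
and "isospectral" = equal multiplicity functions `k ↦ dim E_{k(k+2)}` (Corollary 2.3: the spectrum of `L(q;p₁,p₂)` is
`{k(k+2) : dim E_{k(k+2)} ≠ 0}` with these multiplicities).

## The proof, as printed and as formalised

(3.9): `F(z) = (1/q)∑_l ∑_k (χ_k(g^l) − χ_{k−2}(g^l))z^k` by (3.10), and `∑_k χ̃_k(g^l)z^k = (1 − z²)∏ᵢ(1 − γ^{pᵢl}z)^{−1}(1 −
γ^{−pᵢl}z)^{−1}` by the formal expansion (3.4)–(3.5). Formally (§2): row g43-#2 proved `(1 − 2c₁X + X²)(1 − 2c₂X + X²)·∑_kχ̃_k(c₁,c₂)X^k =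
1 − X²` in `ℝ⟦X⟧`; mapped to `ℂ⟦X⟧` and combined with the Cauchy product of the (finite) quartic with the absolutely convergent
series `∑χ̃_k z^k` (`|χ̃_k| ≤ 2(k+1)³`, row g43-#3) this gives `(1 − 2cos φ₁z + z²)(1 − 2cos φ₂z + z²)·∑_kχ̃_k z^k = 1 − z²` as
NUMBERS for `|z| < 1`, and `(1 − e^{iφ}z)(1 − e^{−iφ}z) = 1 − 2cos φ·z + z² ≠ 0` there; summing over `l` with (3.10) gives (3.8).
§3: each `γ^{±pᵢl}` is a `q`-th root of unity, so for `z^q ≠ 1` no denominator vanishes (differentiability); for `pᵢ` prime to `q`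
and `0 < l < q`, `γ^{±pᵢl} ≠ 1`, so only the term `l = 0`, `(1 − z²)/(1 − z)⁴ = (1 + z)/(1 − z)³`, is singular at `z = 1`:
`(1 − z)³F(z) → (1/q)·2`. Corollary 3.3: equal multiplicities give equal power series, hence equal limits `2/q = 2/q'` along
`z → 1` inside the disc. Proposition 3.1: "⇒" termwise; "⇐" by uniqueness of the Taylor coefficients of a function holomorphic
on the disc.

## What is proved

* §1 (private tools): `hasSum_coeff_coe_mul_mk_mul_pow` (polynomial × absolutely convergent series = Cauchy product),
  `one_sub_exp_mul_mul_one_sub_exp_neg_mul` (`(1 − e^{iφ}z)(1 − e^{−iφ}z) = 1 − 2cos φ·z + z²`), nonvanishing on the disc,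
  `summable_norm_threeSphereHarmonicCharacter_mul_pow`, `coe_quartic_mul_mk_threeSphereHarmonicCharacter` (the `ℂ⟦X⟧` identity),
  `eq_of_tsum_mul_pow_eq` (uniqueness of coefficients on the unit disc).
* §2: **`hasSum_threeSphereHarmonicCharacter_mul_pow`** (one term of (3.8): `∑_kχ̃_k(cos φ₁,cos φ₂)z^k = (1 − z²)/((1 − e^{iφ₁}z)(1 −
  e^{−iφ₁}z)(1 − e^{iφ₂}z)(1 − e^{−iφ₂}z))`), **`hasSum_lensMultiplicity_mul_pow`** (THEOREM 3.2 (3.8)), `tsum_lensMultiplicity_mul_pow`,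
  `summable_norm_lensMultiplicity_mul_pow`, **`lensMultiplicity_eq_iff_generatingFunction_eq`** (PROPOSITION 3.1).
* §3: **`differentiableAt_lensGeneratingFunction`** (poles only at `q`-th roots of unity),
  **`tendsto_one_sub_pow_three_mul_lensGeneratingFunction`** ((3.11) for the closed form, at `𝓝[≠] 1`),
  **`tendsto_one_sub_pow_three_mul_tsum_lensMultiplicity_mul_pow`** ((3.11) for the series, `z → 1` inside the disc),
  **`eq_of_lensMultiplicity_eq`** (COROLLARY 3.3: the spectrum of a three-dimensional lens space determines `q`).

## References

* [IkedaYamamoto1979] A. Ikeda, Y. Yamamoto, *On the spectra of 3-dimensional lens spaces*, Osaka J. Math. 16 (1979) 447–469,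
  §3: (3.6), Proposition 3.1 (3.7), Theorem 3.2 (3.8)–(3.9), (3.11), Corollary 3.3.
* [Ikeda1980] A. Ikeda, *On lens spaces which are isospectral but not isometric*, Ann. Sci. ÉNS (4) 13 (1980) 303–315, §2
  (2.2)–(2.3) (the same generating function in dimension `2n − 1`).
-/

noncomputable section

open Finset Filter Topology Complex

namespace Literature.Analysis.InnerProduct

open _root_.Real _root_.Filter _root_.Topology _root_.Polynomial

/-! ### §1 Tools: the Cauchy product of a polynomial with an absolutely convergent power series; the factors
`(1 − e^{iφ}z)(1 − e^{−iφ}z) = 1 − 2cos φ·z + z²`; uniqueness of the coefficients of a power series -/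

/-- **Cauchy product of a polynomial `P` with an absolutely convergent power series** `∑ s_k z^k`:
`∑_n [Xⁿ](P·∑ s_kX^k)·zⁿ = P(z)·∑_k s_k z^k`. [folklore] -/
private theorem hasSum_coeff_coe_mul_mk_mul_pow (P : ℂ[X]) {s : ℕ → ℂ} {z : ℂ}
    (hs : Summable fun k : ℕ ↦ ‖s k * z ^ k‖) :
    HasSum (fun n : ℕ ↦ PowerSeries.coeff n ((P : PowerSeries ℂ) * PowerSeries.mk s) * z ^ n)
      (P.eval z * ∑' k : ℕ, s k * z ^ k) := by
  set f : ℕ → ℂ := fun i ↦ P.coeff i * z ^ i with hf_def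
  have hf0 : ∀ i ∉ P.support, f i = 0 := fun i hi ↦ by
    rw [hf_def]
    simp only [Polynomial.notMem_support_iff.mp hi, zero_mul]
  have hfn : Summable fun i ↦ ‖f i‖ :=
    summable_of_ne_finset_zero (s := P.support) fun i hi ↦ by rw [hf0 i hi, norm_zero]
  have hfsum : ∑' i, f i = P.eval z := by
    rw [(hasSum_sum_of_ne_finset_zero hf0).tsum_eq, Polynomial.eval_eq_sum, Polynomial.sum_def]
  have hprod := tsum_mul_tsum_eq_tsum_sum_antidiagonal_of_summable_norm hfn hs
  have hsum : Summable fun n : ℕ ↦ ∑ kl ∈ antidiagonal n, f kl.1 * (s kl.2 * z ^ kl.2) :=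
    (summable_norm_sum_mul_antidiagonal_of_summable_norm hfn hs).of_norm
  have key : (fun n : ℕ ↦ ∑ kl ∈ antidiagonal n, f kl.1 * (s kl.2 * z ^ kl.2)) =
      fun n : ℕ ↦ PowerSeries.coeff n ((P : PowerSeries ℂ) * PowerSeries.mk s) * z ^ n := by
    funext n
    rw [PowerSeries.coeff_mul, Finset.sum_mul]
    refine Finset.sum_congr rfl fun kl hkl ↦ ?_
    rw [Polynomial.coeff_coe, PowerSeries.coeff_mk, hf_def, ← mem_antidiagonal.mp hkl, pow_add]
    ring
  have h := hsum.hasSum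
  rwa [← hprod, hfsum, key] at h

/-- `(1 − e^{iφ}z)(1 − e^{−iφ}z) = 1 − 2cos φ·z + z²`. [folklore] -/
private theorem one_sub_exp_mul_mul_one_sub_exp_neg_mul (φ : ℝ) (z : ℂ) :
    (1 - cexp (φ * I) * z) * (1 - cexp (-φ * I) * z) = 1 - 2 * (Real.cos φ : ℂ) * z + z ^ 2 := by
  have h1 : cexp (φ * I) * cexp (-φ * I) = 1 := by rw [← Complex.exp_add]; simp
  have h2 : cexp (φ * I) + cexp (-φ * I) = 2 * (Real.cos φ : ℂ) := by rw [Complex.ofReal_cos, Complex.two_cos]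
  linear_combination (-z) * h2 + z ^ 2 * h1

/-- `1 − e^{ix}z ≠ 0` for `|z| < 1`. [folklore] -/
private theorem one_sub_exp_mul_mul_ne_zero (x : ℝ) {z : ℂ} (hz : ‖z‖ < 1) : 1 - cexp (x * I) * z ≠ 0 := by
  intro h
  have h1 := congrArg (‖·‖) (sub_eq_zero.mp h)
  simp only [norm_one, norm_mul, Complex.norm_exp_ofReal_mul_I, one_mul] at h1
  linarith

/-- `1 − e^{−ix}z ≠ 0` for `|z| < 1`. [folklore] -/
private theorem one_sub_exp_neg_mul_mul_ne_zero (x : ℝ) {z : ℂ} (hz : ‖z‖ < 1) : 1 - cexp (-x * I) * z ≠ 0 := by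
  have h := one_sub_exp_mul_mul_ne_zero (-x) hz
  push_cast at h
  exact h

/-- `|χ̃_k(cos φ₁, cos φ₂)z^k| ≤ 2(k+1)³|z|^k` is summable for `|z| < 1`. [folklore] -/
private theorem summable_norm_threeSphereHarmonicCharacter_mul_pow (φ₁ φ₂ : ℝ) {z : ℂ} (hz : ‖z‖ < 1) :
    Summable fun k : ℕ ↦ ‖(threeSphereHarmonicCharacter k (Real.cos φ₁) (Real.cos φ₂) : ℂ) * z ^ k‖ := by
  have hr : ‖(‖z‖ : ℝ)‖ < 1 := by rwa [Real.norm_of_nonneg (norm_nonneg z)]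
  have h1 : Summable fun k : ℕ ↦ ((k : ℝ) ^ 3 * ‖z‖ ^ k) := summable_pow_mul_geometric_of_norm_lt_one 3 hr
  have h2 : Summable fun k : ℕ ↦ ‖z‖ ^ k := summable_geometric_of_lt_one (norm_nonneg _) hz
  refine .of_nonneg_of_le (fun k ↦ norm_nonneg _) (fun k ↦ ?_) ((h1.mul_left 16).add (h2.mul_left 2))
  rw [norm_mul, norm_pow, Complex.norm_real, Real.norm_eq_abs]
  have hb := abs_threeSphereHarmonicCharacter_cos_cos_le k φ₁ φ₂
  have hk : (2 : ℝ) * ((k : ℝ) + 1) ^ 3 ≤ 16 * (k : ℝ) ^ 3 + 2 := by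
    rcases Nat.eq_zero_or_pos k with rfl | hk
    · norm_num
    · have hk1 : (1 : ℝ) ≤ k := Nat.one_le_cast.mpr hk
      have h3 : ((k : ℝ) + 1) ^ 3 ≤ (2 * k) ^ 3 := pow_le_pow_left₀ (by positivity) (by linarith) 3
      nlinarith [h3]
  have hzk : 0 ≤ ‖z‖ ^ k := pow_nonneg (norm_nonneg _) _
  calc |threeSphereHarmonicCharacter k (Real.cos φ₁) (Real.cos φ₂)| * ‖z‖ ^ k ≤ 2 * ((k : ℝ) + 1) ^ 3 * ‖z‖ ^ k :=
        mul_le_mul_of_nonneg_right hb hzk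
    _ ≤ (16 * (k : ℝ) ^ 3 + 2) * ‖z‖ ^ k := mul_le_mul_of_nonneg_right hk hzk
    _ = 16 * ((k : ℝ) ^ 3 * ‖z‖ ^ k) + 2 * ‖z‖ ^ k := by ring

/-- The quartic `(1 − 2c₁X + X²)(1 − 2c₂X + X²) ∈ ℂ[X]` as a power series, times `∑ χ̃_k(c₁,c₂)X^k`, is `1 − X²`
(Ikeda–Yamamoto's Theorem 3.2 coefficientwise, `LensSpaceSpectrum.quadratic_mul_quadratic_mul_mk_threeSphereHarmonicCharacter`,
mapped from `ℝ⟦X⟧` to `ℂ⟦X⟧`). [cite: IkedaYamamoto1979, Theorem 3.2 (3.8)–(3.9)] -/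
private theorem coe_quartic_mul_mk_threeSphereHarmonicCharacter (c₁ c₂ : ℝ) :
    (((1 - Polynomial.C (2 * (c₁ : ℂ)) * Polynomial.X + Polynomial.X ^ 2) *
        (1 - Polynomial.C (2 * (c₂ : ℂ)) * Polynomial.X + Polynomial.X ^ 2) : ℂ[X]) : PowerSeries ℂ) *
      PowerSeries.mk (fun k : ℕ ↦ (threeSphereHarmonicCharacter k c₁ c₂ : ℂ)) = 1 - PowerSeries.X ^ 2 := by
  have h := congrArg (PowerSeries.map Complex.ofRealHom) (quadratic_mul_quadratic_mul_mk_threeSphereHarmonicCharacter c₁ c₂)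
  have hquad : ∀ c : ℝ, PowerSeries.map Complex.ofRealHom
      ((1 : PowerSeries ℝ) - PowerSeries.C (2 * c) * PowerSeries.X + PowerSeries.X ^ 2) =
      (((1 - Polynomial.C (2 * (c : ℂ)) * Polynomial.X + Polynomial.X ^ 2 : ℂ[X])) : PowerSeries ℂ) := fun c ↦ by
    rw [map_add, map_sub, map_one, map_mul, PowerSeries.map_C, PowerSeries.map_X, map_pow, PowerSeries.map_X,
      Polynomial.coe_add, Polynomial.coe_sub, Polynomial.coe_one, Polynomial.coe_mul, Polynomial.coe_pow,
      Polynomial.coe_C, Polynomial.coe_X]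
    simp
  have hmk : PowerSeries.map Complex.ofRealHom (PowerSeries.mk fun k : ℕ ↦ threeSphereHarmonicCharacter k c₁ c₂) =
      PowerSeries.mk fun k : ℕ ↦ (threeSphereHarmonicCharacter k c₁ c₂ : ℂ) := by
    ext n
    simp [PowerSeries.coeff_map]
  rw [map_mul, map_mul, hquad, hquad, hmk, map_sub, map_one, map_pow, PowerSeries.map_X] at h
  rw [← Polynomial.coe_mul] at h
  exact h

/-- **A power series converging absolutely on the unit disc is determined by its sum there** (uniqueness of Taylor
coefficients, via Mathlib's `HasFPowerSeriesAt.eq_formalMultilinearSeries`). [folklore] -/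
private theorem eq_of_tsum_mul_pow_eq {a b : ℕ → ℂ} (ha : ∀ z : ℂ, ‖z‖ < 1 → Summable fun k : ℕ ↦ ‖a k * z ^ k‖)
    (hb : ∀ z : ℂ, ‖z‖ < 1 → Summable fun k : ℕ ↦ ‖b k * z ^ k‖)
    (h : ∀ z : ℂ, ‖z‖ < 1 → ∑' k : ℕ, a k * z ^ k = ∑' k : ℕ, b k * z ^ k) : a = b := by
  have hps : ∀ {c : ℕ → ℂ}, (∀ z : ℂ, ‖z‖ < 1 → Summable fun k : ℕ ↦ ‖c k * z ^ k‖) →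
      HasFPowerSeriesOnBall (fun z : ℂ ↦ ∑' k : ℕ, c k * z ^ k) (FormalMultilinearSeries.ofScalars ℂ c) 0 1 := by
    intro c hc
    refine ⟨?_, one_pos, fun {y} hy ↦ ?_⟩
    · refine ENNReal.le_of_forall_nnreal_lt fun r hr ↦ FormalMultilinearSeries.le_radius_of_summable _ ?_
      have hr' : ‖(r : ℂ)‖ < 1 := by
        rw [Complex.norm_real, NNReal.norm_eq]
        exact_mod_cast hr
      refine (hc r hr').congr fun n ↦ ?_
      rw [FormalMultilinearSeries.ofScalars_norm_eq_mul, ContinuousMultilinearMap.norm_mkPiAlgebraFin, mul_one,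
        norm_mul, norm_pow, Complex.norm_real, NNReal.norm_eq]
    · have hy' : ‖y‖ < 1 := by
        rwa [mem_eball_zero_iff, ← ofReal_norm, ENNReal.ofReal_lt_one] at hy
      simp only [FormalMultilinearSeries.ofScalars_apply_eq, smul_eq_mul, zero_add]
      exact (hc y hy').of_norm.hasSum
  have hfa := (hps ha).hasFPowerSeriesAt
  have hfb := (hps hb).hasFPowerSeriesAt
  have heq : (fun z : ℂ ↦ ∑' k : ℕ, a k * z ^ k) =ᶠ[𝓝 0] fun z : ℂ ↦ ∑' k : ℕ, b k * z ^ k := by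
    filter_upwards [Metric.ball_mem_nhds (0 : ℂ) one_pos] with z hz
    exact h z (mem_ball_zero_iff.mp hz)
  have hp := (hfa.congr heq).eq_formalMultilinearSeries hfb
  funext n
  have := congrArg (fun p : FormalMultilinearSeries ℂ ℂ ℂ ↦ p n fun _ ↦ 1) hp
  simpa [FormalMultilinearSeries.ofScalars_apply_eq] using this

/-! ### §2 Theorem 3.2: the generating function `F(z) = ∑_k dim E_{k(k+2)}·z^k` on the unit disc -/

/-- **One term of (3.8)**: for `|z| < 1`, `∑_k χ̃_k(cos φ₁, cos φ₂)z^k = (1 − z²)/((1 − e^{iφ₁}z)(1 − e^{−iφ₁}z)(1 − e^{iφ₂}z)(1 − e^{−iφ₂}z))`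
— the character of `⊕_k H_k z^k` at the torus element `diag(e^{iφ₁}, e^{iφ₂})`: by (3.1) and (3.4)–(3.5), `χ̃_k(g^l) = χ_k(g^l) −
χ_{k−2}(g^l)` is the `z^k`-coefficient of `(1 − z²)∏ᵢ(1 − γ^{pᵢl}z)^{−1}(1 − γ^{−pᵢl}z)^{−1}` (the step (3.9) of the printed proof),
here as a convergent series on `|z| < 1`. [cite: IkedaYamamoto1979, §3 (3.1), (3.4)–(3.5), proof of Theorem 3.2 (3.9)] -/
theorem hasSum_threeSphereHarmonicCharacter_mul_pow (φ₁ φ₂ : ℝ) {z : ℂ} (hz : ‖z‖ < 1) :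
    HasSum (fun k : ℕ ↦ (threeSphereHarmonicCharacter k (Real.cos φ₁) (Real.cos φ₂) : ℂ) * z ^ k)
      ((1 - z ^ 2) / ((1 - cexp (φ₁ * I) * z) * (1 - cexp (-φ₁ * I) * z) *
        ((1 - cexp (φ₂ * I) * z) * (1 - cexp (-φ₂ * I) * z)))) := by
  have hs := summable_norm_threeSphereHarmonicCharacter_mul_pow φ₁ φ₂ hz
  have h1 := hasSum_coeff_coe_mul_mk_mul_pow ((1 - Polynomial.C (2 * (Real.cos φ₁ : ℂ)) * Polynomial.X + Polynomial.X ^ 2) *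
    (1 - Polynomial.C (2 * (Real.cos φ₂ : ℂ)) * Polynomial.X + Polynomial.X ^ 2)) hs
  rw [coe_quartic_mul_mk_threeSphereHarmonicCharacter] at h1
  have h2 : HasSum (fun n : ℕ ↦ PowerSeries.coeff n ((1 : PowerSeries ℂ) - PowerSeries.X ^ 2) * z ^ n) (1 - z ^ 2) := by
    have h0 : ∀ n ∉ ({0, 2} : Finset ℕ), PowerSeries.coeff n ((1 : PowerSeries ℂ) - PowerSeries.X ^ 2) * z ^ n = 0 := by
      intro n hn
      simp only [Finset.mem_insert, Finset.mem_singleton, not_or] at hn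
      rw [map_sub, PowerSeries.coeff_one, PowerSeries.coeff_X_pow, if_neg hn.1, if_neg hn.2, sub_zero, zero_mul]
    have e : ∑ n ∈ ({0, 2} : Finset ℕ), PowerSeries.coeff n ((1 : PowerSeries ℂ) - PowerSeries.X ^ 2) * z ^ n = 1 - z ^ 2 := by
      rw [Finset.sum_pair (by norm_num : (0 : ℕ) ≠ 2)]
      simp only [map_sub, PowerSeries.coeff_one, PowerSeries.coeff_X_pow]
      norm_num
      ring
    have h : HasSum (fun n : ℕ ↦ PowerSeries.coeff n ((1 : PowerSeries ℂ) - PowerSeries.X ^ 2) * z ^ n)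
        (∑ n ∈ ({0, 2} : Finset ℕ), PowerSeries.coeff n ((1 : PowerSeries ℂ) - PowerSeries.X ^ 2) * z ^ n) :=
      hasSum_sum_of_ne_finset_zero h0
    rwa [e] at h
  have h3 := h1.unique h2
  have hPz : Polynomial.eval z ((1 - Polynomial.C (2 * (Real.cos φ₁ : ℂ)) * Polynomial.X + Polynomial.X ^ 2) *
      (1 - Polynomial.C (2 * (Real.cos φ₂ : ℂ)) * Polynomial.X + Polynomial.X ^ 2)) =
      (1 - cexp (φ₁ * I) * z) * (1 - cexp (-φ₁ * I) * z) * ((1 - cexp (φ₂ * I) * z) * (1 - cexp (-φ₂ * I) * z)) := by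
    rw [one_sub_exp_mul_mul_one_sub_exp_neg_mul, one_sub_exp_mul_mul_one_sub_exp_neg_mul]
    simp only [Polynomial.eval_mul, Polynomial.eval_add, Polynomial.eval_sub, Polynomial.eval_one, Polynomial.eval_C,
      Polynomial.eval_X, Polynomial.eval_pow]
  have hne : (1 - cexp (φ₁ * I) * z) * (1 - cexp (-φ₁ * I) * z) * ((1 - cexp (φ₂ * I) * z) * (1 - cexp (-φ₂ * I) * z)) ≠ 0 :=
    mul_ne_zero (mul_ne_zero (one_sub_exp_mul_mul_ne_zero φ₁ hz) (one_sub_exp_neg_mul_mul_ne_zero φ₁ hz))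
      (mul_ne_zero (one_sub_exp_mul_mul_ne_zero φ₂ hz) (one_sub_exp_neg_mul_mul_ne_zero φ₂ hz))
  rw [hPz] at h3
  have h4 : ∑' k : ℕ, (threeSphereHarmonicCharacter k (Real.cos φ₁) (Real.cos φ₂) : ℂ) * z ^ k =
      (1 - z ^ 2) / ((1 - cexp (φ₁ * I) * z) * (1 - cexp (-φ₁ * I) * z) *
        ((1 - cexp (φ₂ * I) * z) * (1 - cexp (-φ₂ * I) * z))) := by
    rw [eq_div_iff hne, mul_comm]
    exact h3
  rw [← h4]
  exact hs.of_norm.hasSum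

/-- `e^{i·(2πlp/q)} = γ^{lp}`, `γ = e^{2πi/q}`: the real-angle and the complex forms of the torus eigenvalues. [folklore] -/
private theorem exp_ofReal_two_pi_mul_div_mul_I (q l : ℕ) (p : ℤ) :
    cexp (((2 * π * l * p / q : ℝ) : ℂ) * I) = cexp (2 * π * I * l * p / q) ∧
      cexp (-((2 * π * l * p / q : ℝ) : ℂ) * I) = cexp (-(2 * π * I * l * p / q)) := by
  constructor <;> (congr 1; push_cast; ring)

/-- **THEOREM 3.2 (Ikeda–Yamamoto 1979) for the three-dimensional lens spaces**: "Let `L(q : p₀, ⋯, p_n)` be a lens space and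
`F(z)` the generating function associated to the spectrum of `L(q : p₀, ⋯, p_n)` [`F(z) = ∑_k dim E_{k(k+2n)}·z^k`]. Then `F(z)`
has the following form on the domain `{z ∈ ℂ : |z| < 1}`: (3.8) `F(z) = (1/q)∑_{l=0}^{q−1}(1 − z²)/∏_{i=0}^{n}(1 − γ^{pᵢl}z)(1 −
γ^{−pᵢl}z)`", `γ = e^{2πi/q}`; here `n + 1 = 2`, `dim E_{k(k+2)} = lensMultiplicity q p₁ p₂ k`, `γ^{±pᵢl} = e^{±2πi·lpᵢ/q}`.
[cite: IkedaYamamoto1979, Theorem 3.2 (3.8)] -/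
theorem hasSum_lensMultiplicity_mul_pow (q : ℕ) (hq : q ≠ 0) (p₁ p₂ : ℤ) {z : ℂ} (hz : ‖z‖ < 1) :
    HasSum (fun k : ℕ ↦ (lensMultiplicity q p₁ p₂ k : ℂ) * z ^ k)
      (1 / (q : ℂ) * ∑ l ∈ range q, (1 - z ^ 2) /
        ((1 - cexp (2 * π * I * l * p₁ / q) * z) * (1 - cexp (-(2 * π * I * l * p₁ / q)) * z) *
          ((1 - cexp (2 * π * I * l * p₂ / q) * z) * (1 - cexp (-(2 * π * I * l * p₂ / q)) * z)))) := by
  have h := fun l : ℕ ↦ hasSum_threeSphereHarmonicCharacter_mul_pow (2 * π * l * p₁ / q) (2 * π * l * p₂ / q) hz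
  have hsum : HasSum (fun k : ℕ ↦ 1 / (q : ℂ) * ∑ l ∈ range q,
      (threeSphereHarmonicCharacter k (Real.cos (2 * π * l * p₁ / q)) (Real.cos (2 * π * l * p₂ / q)) : ℂ) * z ^ k)
      (1 / (q : ℂ) * ∑ l ∈ range q, (1 - z ^ 2) /
        ((1 - cexp (((2 * π * l * p₁ / q : ℝ) : ℂ) * I) * z) * (1 - cexp (-((2 * π * l * p₁ / q : ℝ) : ℂ) * I) * z) *
          ((1 - cexp (((2 * π * l * p₂ / q : ℝ) : ℂ) * I) * z) * (1 - cexp (-((2 * π * l * p₂ / q : ℝ) : ℂ) * I) * z)))) :=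
    (hasSum_sum fun l (_ : l ∈ range q) ↦ h l).mul_left (1 / (q : ℂ))
  have e1 : (fun k : ℕ ↦ (lensMultiplicity q p₁ p₂ k : ℂ) * z ^ k) = fun k : ℕ ↦ 1 / (q : ℂ) * ∑ l ∈ range q,
      (threeSphereHarmonicCharacter k (Real.cos (2 * π * l * p₁ / q)) (Real.cos (2 * π * l * p₂ / q)) : ℂ) * z ^ k := by
    funext k
    rw [show (lensMultiplicity q p₁ p₂ k : ℂ) = ((lensMultiplicity q p₁ p₂ k : ℝ) : ℂ) by norm_cast,
      lensMultiplicity_eq_sum_threeSphereHarmonicCharacter q hq p₁ p₂ k]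
    push_cast
    rw [mul_assoc, Finset.sum_mul]
  have e2 : ∑ l ∈ range q, (1 - z ^ 2) /
        ((1 - cexp (((2 * π * l * p₁ / q : ℝ) : ℂ) * I) * z) * (1 - cexp (-((2 * π * l * p₁ / q : ℝ) : ℂ) * I) * z) *
          ((1 - cexp (((2 * π * l * p₂ / q : ℝ) : ℂ) * I) * z) * (1 - cexp (-((2 * π * l * p₂ / q : ℝ) : ℂ) * I) * z))) =
      ∑ l ∈ range q, (1 - z ^ 2) /
        ((1 - cexp (2 * π * I * l * p₁ / q) * z) * (1 - cexp (-(2 * π * I * l * p₁ / q)) * z) *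
          ((1 - cexp (2 * π * I * l * p₂ / q) * z) * (1 - cexp (-(2 * π * I * l * p₂ / q)) * z))) := by
    refine Finset.sum_congr rfl fun l _ ↦ ?_
    rw [(exp_ofReal_two_pi_mul_div_mul_I q l p₁).1, (exp_ofReal_two_pi_mul_div_mul_I q l p₁).2,
      (exp_ofReal_two_pi_mul_div_mul_I q l p₂).1, (exp_ofReal_two_pi_mul_div_mul_I q l p₂).2]
  rw [e1, ← e2]
  exact hsum

/-- The generating function as the sum of its power series: `∑_k dim E_{k(k+2)}z^k = (3.8)` on the unit disc.
[cite: IkedaYamamoto1979, Theorem 3.2 (3.8)] -/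
theorem tsum_lensMultiplicity_mul_pow (q : ℕ) (hq : q ≠ 0) (p₁ p₂ : ℤ) {z : ℂ} (hz : ‖z‖ < 1) :
    ∑' k : ℕ, (lensMultiplicity q p₁ p₂ k : ℂ) * z ^ k =
      1 / (q : ℂ) * ∑ l ∈ range q, (1 - z ^ 2) /
        ((1 - cexp (2 * π * I * l * p₁ / q) * z) * (1 - cexp (-(2 * π * I * l * p₁ / q)) * z) *
          ((1 - cexp (2 * π * I * l * p₂ / q) * z) * (1 - cexp (-(2 * π * I * l * p₂ / q)) * z))) :=
  (hasSum_lensMultiplicity_mul_pow q hq p₁ p₂ hz).tsum_eq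

/-- `F(z) = ∑_k dim E_{k(k+2)}·z^k` converges absolutely on the unit disc (nonnegative integer coefficients; at `|z|` it is
(3.8)). [cite: IkedaYamamoto1979, Theorem 3.2] -/
theorem summable_norm_lensMultiplicity_mul_pow (q : ℕ) (hq : q ≠ 0) (p₁ p₂ : ℤ) {z : ℂ} (hz : ‖z‖ < 1) :
    Summable fun k : ℕ ↦ ‖(lensMultiplicity q p₁ p₂ k : ℂ) * z ^ k‖ := by
  have h := (hasSum_lensMultiplicity_mul_pow q hq p₁ p₂ (z := ((‖z‖ : ℝ) : ℂ))
    (by rwa [Complex.norm_real, Real.norm_of_nonneg (norm_nonneg z)])).summable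
  have e : (fun k : ℕ ↦ (lensMultiplicity q p₁ p₂ k : ℂ) * ((‖z‖ : ℝ) : ℂ) ^ k) =
      fun k : ℕ ↦ (((lensMultiplicity q p₁ p₂ k : ℝ) * ‖z‖ ^ k : ℝ) : ℂ) := by
    funext k
    push_cast
    ring
  rw [e, Complex.summable_ofReal] at h
  refine h.congr fun k ↦ ?_
  rw [norm_mul, norm_pow, Complex.norm_natCast]

/-- **PROPOSITION 3.1 (Ikeda–Yamamoto 1979)**, `n + 1 = 2`: "The lens space `L(q : p₀, ⋯, p_n)` is isospectral to `L(q' : p'₀,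
⋯, p'_n)` if and only if `F(z) = E(z)`" — the two spectra (= the two multiplicity functions `k ↦ dim E_{k(k+2)}`, Corollary
2.3) coincide iff the two generating functions (3.8) coincide on the unit disc (uniqueness of Taylor coefficients).
[cite: IkedaYamamoto1979, Proposition 3.1 (3.7)] -/
theorem lensMultiplicity_eq_iff_generatingFunction_eq (q q' : ℕ) (hq : q ≠ 0) (hq' : q' ≠ 0) (p₁ p₂ p₁' p₂' : ℤ) :
    (∀ k : ℕ, lensMultiplicity q p₁ p₂ k = lensMultiplicity q' p₁' p₂' k) ↔
      ∀ z : ℂ, ‖z‖ < 1 →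
        1 / (q : ℂ) * ∑ l ∈ range q, (1 - z ^ 2) /
            ((1 - cexp (2 * π * I * l * p₁ / q) * z) * (1 - cexp (-(2 * π * I * l * p₁ / q)) * z) *
              ((1 - cexp (2 * π * I * l * p₂ / q) * z) * (1 - cexp (-(2 * π * I * l * p₂ / q)) * z))) =
          1 / (q' : ℂ) * ∑ l ∈ range q', (1 - z ^ 2) /
            ((1 - cexp (2 * π * I * l * p₁' / q') * z) * (1 - cexp (-(2 * π * I * l * p₁' / q')) * z) *
              ((1 - cexp (2 * π * I * l * p₂' / q') * z) * (1 - cexp (-(2 * π * I * l * p₂' / q')) * z))) := by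
  constructor
  · intro h z hz
    rw [← tsum_lensMultiplicity_mul_pow q hq p₁ p₂ hz, ← tsum_lensMultiplicity_mul_pow q' hq' p₁' p₂' hz]
    exact tsum_congr fun k ↦ by rw [h k]
  · intro h
    have key := eq_of_tsum_mul_pow_eq (fun z hz ↦ summable_norm_lensMultiplicity_mul_pow q hq p₁ p₂ hz)
      (fun z hz ↦ summable_norm_lensMultiplicity_mul_pow q' hq' p₁' p₂' hz) fun z hz ↦ by
        rw [tsum_lensMultiplicity_mul_pow q hq p₁ p₂ hz, tsum_lensMultiplicity_mul_pow q' hq' p₁' p₂' hz, h z hz]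
    intro k
    have hk := congrFun key k
    exact_mod_cast hk

/-! ### §3 `F` is meromorphic with poles only at `q`-th roots of unity; the pole of order `3` at `z = 1`:
`lim_{z→1}(1−z)³F(z) = 2/q` (3.11); Corollary 3.3: the spectrum determines `q` -/

/-- `γ^{lp}` is a `q`-th root of unity: `(e^{2πi·lp/q})^q = 1`, and so is `γ^{−lp}`. [folklore] -/
private theorem exp_two_pi_mul_div_pow_eq_one (q : ℕ) (hq : q ≠ 0) (l : ℕ) (p : ℤ) :
    cexp (2 * π * I * l * p / q) ^ q = 1 ∧ cexp (-(2 * π * I * l * p / q)) ^ q = 1 := by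
  have hq0 : (q : ℂ) ≠ 0 := Nat.cast_ne_zero.mpr hq
  have key : cexp (2 * π * I * l * p / q) ^ q = 1 := by
    rw [← Complex.exp_nat_mul, ← mul_div_assoc, mul_div_cancel_left₀ _ hq0,
      show (2 * π * I * l * p : ℂ) = ((l * p : ℤ) : ℂ) * (2 * π * I) by push_cast; ring]
    exact Complex.exp_int_mul_two_pi_mul_I (l * p)
  refine ⟨key, ?_⟩
  rw [Complex.exp_neg, inv_pow, key, inv_one]

/-- `1 − ωz ≠ 0` when `ω^q = 1` and `z^q ≠ 1`. [folklore] -/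
private theorem one_sub_mul_ne_zero_of_pow_eq_one {ω z : ℂ} {q : ℕ} (hω : ω ^ q = 1) (hz : z ^ q ≠ 1) : 1 - ω * z ≠ 0 := by
  intro h
  have h1 : ω * z = 1 := (sub_eq_zero.mp h).symm
  have h2 := congrArg (· ^ q) h1
  simp only [mul_pow, hω, one_mul, one_pow] at h2
  exact hz h2

/-- "`F(z)` can be considered as a meromorphic function on the whole complex plane `ℂ`. Any pole of `F(z)` is an `q`-th root
of one": the closed form (3.8) is a rational function of `z`, complex-differentiable at every `z` with `z^q ≠ 1` (its
denominators `1 − γ^{±pᵢl}z` vanish only at `q`-th roots of unity). [cite: IkedaYamamoto1979, §3, proof of Corollary 3.3 (p. 453)] -/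
theorem differentiableAt_lensGeneratingFunction (q : ℕ) (hq : q ≠ 0) (p₁ p₂ : ℤ) {z : ℂ} (hz : z ^ q ≠ 1) :
    DifferentiableAt ℂ (fun z : ℂ ↦ 1 / (q : ℂ) * ∑ l ∈ range q, (1 - z ^ 2) /
        ((1 - cexp (2 * π * I * l * p₁ / q) * z) * (1 - cexp (-(2 * π * I * l * p₁ / q)) * z) *
          ((1 - cexp (2 * π * I * l * p₂ / q) * z) * (1 - cexp (-(2 * π * I * l * p₂ / q)) * z)))) z := by
  refine (DifferentiableAt.fun_sum fun l _ ↦ ?_).const_mul _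
  have hD : (1 - cexp (2 * π * I * l * p₁ / q) * z) * (1 - cexp (-(2 * π * I * l * p₁ / q)) * z) *
      ((1 - cexp (2 * π * I * l * p₂ / q) * z) * (1 - cexp (-(2 * π * I * l * p₂ / q)) * z)) ≠ 0 :=
    mul_ne_zero
      (mul_ne_zero (one_sub_mul_ne_zero_of_pow_eq_one (exp_two_pi_mul_div_pow_eq_one q hq l p₁).1 hz)
        (one_sub_mul_ne_zero_of_pow_eq_one (exp_two_pi_mul_div_pow_eq_one q hq l p₁).2 hz))
      (mul_ne_zero (one_sub_mul_ne_zero_of_pow_eq_one (exp_two_pi_mul_div_pow_eq_one q hq l p₂).1 hz)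
        (one_sub_mul_ne_zero_of_pow_eq_one (exp_two_pi_mul_div_pow_eq_one q hq l p₂).2 hz))
  fun_prop (disch := exact hD)

/-- For `0 < l < q` and `p` prime to `q`: `γ^{lp} ≠ 1` and `γ^{−lp} ≠ 1` (`q ∤ lp`; `two_pi_mul_div_ne_of_isCoprime`). [folklore] -/
private theorem exp_two_pi_mul_div_ne_one {q : ℕ} {p : ℤ} (hp : IsCoprime p q) {l : ℕ} (hl : 0 < l) (hlq : l < q) :
    cexp (2 * π * I * l * p / q) ≠ 1 ∧ cexp (-(2 * π * I * l * p / q)) ≠ 1 := by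
  have key : cexp (2 * π * I * l * p / q) ≠ 1 := by
    intro h
    obtain ⟨m, hm⟩ := Complex.exp_eq_one_iff.mp h
    have e : ((2 * π * l * p / q : ℝ) : ℂ) * I = ((2 * π * m : ℝ) : ℂ) * I := by
      rw [show ((2 * π * l * p / q : ℝ) : ℂ) * I = 2 * π * I * l * p / q by push_cast; ring, hm]
      push_cast
      ring
    have e2 := mul_right_cancel₀ I_ne_zero e
    exact two_pi_mul_div_ne_of_isCoprime hp hl hlq m (by exact_mod_cast e2)
  refine ⟨key, fun h ↦ key ?_⟩
  rwa [Complex.exp_neg, inv_eq_one] at h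

/-- **(3.11) (Ikeda–Yamamoto 1979), `n + 1 = 2`**: "`F(z)` has a pole of order `(2n+1)` at `z = 1`, and
`lim_{z→1}(1−z)^{2n+1}F(z) = 2/q`" — for the closed form (3.8) of the lens space `L(q; p₁, p₂)` (`p₁, p₂` prime to `q`),
`(1−z)³F(z) → 2/q` as `z → 1`, `z ≠ 1`: only the term `l = 0` (`g^l = 1`, denominator `(1−z)⁴`) has a pole of order `3` at
`z = 1`; for `0 < l < q` the denominators do not vanish at `1`. [cite: IkedaYamamoto1979, §3 (3.11)] -/
theorem tendsto_one_sub_pow_three_mul_lensGeneratingFunction (q : ℕ) (hq : q ≠ 0) {p₁ p₂ : ℤ}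
    (hp₁ : IsCoprime p₁ q) (hp₂ : IsCoprime p₂ q) :
    Tendsto (fun z : ℂ ↦ (1 - z) ^ 3 * (1 / (q : ℂ) * ∑ l ∈ range q, (1 - z ^ 2) /
        ((1 - cexp (2 * π * I * l * p₁ / q) * z) * (1 - cexp (-(2 * π * I * l * p₁ / q)) * z) *
          ((1 - cexp (2 * π * I * l * p₂ / q) * z) * (1 - cexp (-(2 * π * I * l * p₂ / q)) * z)))))
      (𝓝[≠] 1) (𝓝 (2 / (q : ℂ))) := by
  obtain ⟨q', rfl⟩ : ∃ q', q = q' + 1 := ⟨q - 1, (Nat.sub_add_cancel (Nat.one_le_iff_ne_zero.mpr hq)).symm⟩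
  -- the terms `0 < l` (shifted: `l + 1`, `l < q'`) are continuous at `z = 1`
  have hcont : ∀ l ∈ range q', ContinuousAt (fun z : ℂ ↦ (1 - z ^ 2) /
      ((1 - cexp (2 * π * I * ((l + 1 : ℕ) : ℂ) * p₁ / ((q' + 1 : ℕ) : ℂ)) * z) *
          (1 - cexp (-(2 * π * I * ((l + 1 : ℕ) : ℂ) * p₁ / ((q' + 1 : ℕ) : ℂ))) * z) *
        ((1 - cexp (2 * π * I * ((l + 1 : ℕ) : ℂ) * p₂ / ((q' + 1 : ℕ) : ℂ)) * z) *
          (1 - cexp (-(2 * π * I * ((l + 1 : ℕ) : ℂ) * p₂ / ((q' + 1 : ℕ) : ℂ))) * z)))) 1 := by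
    intro l hl
    have hl' : l + 1 < q' + 1 := Nat.succ_lt_succ (mem_range.mp hl)
    have h₁ := exp_two_pi_mul_div_ne_one hp₁ (Nat.succ_pos l) hl'
    have h₂ := exp_two_pi_mul_div_ne_one hp₂ (Nat.succ_pos l) hl'
    have hD : (1 - cexp (2 * π * I * ((l + 1 : ℕ) : ℂ) * p₁ / ((q' + 1 : ℕ) : ℂ)) * 1) *
          (1 - cexp (-(2 * π * I * ((l + 1 : ℕ) : ℂ) * p₁ / ((q' + 1 : ℕ) : ℂ))) * 1) *
        ((1 - cexp (2 * π * I * ((l + 1 : ℕ) : ℂ) * p₂ / ((q' + 1 : ℕ) : ℂ)) * 1) *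
          (1 - cexp (-(2 * π * I * ((l + 1 : ℕ) : ℂ) * p₂ / ((q' + 1 : ℕ) : ℂ))) * 1)) ≠ 0 := by
      simp only [mul_one]
      exact mul_ne_zero (mul_ne_zero (sub_ne_zero.mpr h₁.1.symm) (sub_ne_zero.mpr h₁.2.symm))
        (mul_ne_zero (sub_ne_zero.mpr h₂.1.symm) (sub_ne_zero.mpr h₂.2.symm))
    exact ContinuousAt.div (by fun_prop) (by fun_prop) hD
  -- the limit of the regularised expression
  have ht1 : Tendsto (fun z : ℂ ↦ (1 - z) ^ 3) (𝓝[≠] (1 : ℂ)) (𝓝 0) := by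
    have h : Tendsto (fun z : ℂ ↦ (1 - z) ^ 3) (𝓝 1) (𝓝 ((1 - 1) ^ 3)) := (tendsto_const_nhds.sub tendsto_id).pow 3
    rw [sub_self, zero_pow three_ne_zero] at h
    exact h.mono_left nhdsWithin_le_nhds
  have ht2 := tendsto_finsetSum (range q') fun l hl ↦ ((hcont l hl).tendsto.mono_left (nhdsWithin_le_nhds (s := {(1 : ℂ)}ᶜ)))
  have ht3 : Tendsto (fun z : ℂ ↦ 1 + z) (𝓝[≠] (1 : ℂ)) (𝓝 2) := by
    have h : Tendsto (fun z : ℂ ↦ 1 + z) (𝓝 1) (𝓝 (1 + 1)) := tendsto_const_nhds.add tendsto_id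
    rw [one_add_one_eq_two] at h
    exact h.mono_left nhdsWithin_le_nhds
  have hlim := ((ht1.mul ht2).add ht3).const_mul (1 / ((q' + 1 : ℕ) : ℂ))
  rw [zero_mul, zero_add, show 1 / ((q' + 1 : ℕ) : ℂ) * 2 = 2 / ((q' + 1 : ℕ) : ℂ) by ring] at hlim
  refine hlim.congr' ?_
  filter_upwards [self_mem_nhdsWithin] with z hz
  have hz1 : (1 : ℂ) - z ≠ 0 := sub_ne_zero.mpr (Ne.symm hz)
  have key : (1 + z : ℂ) = (1 - z) ^ 3 * ((1 - z ^ 2) / ((1 - z) * (1 - z) * ((1 - z) * (1 - z)))) := by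
    field_simp
    ring
  rw [Finset.sum_range_succ']
  simp only [Nat.cast_zero, mul_zero, zero_mul, zero_div, neg_zero, Complex.exp_zero, one_mul]
  rw [key]
  ring

/-- **(3.11) for the power series itself**: `(1−z)³·∑_k dim E_{k(k+2)}z^k → 2/q` as `z → 1` inside the unit disc (where the
series converges and equals (3.8)). [cite: IkedaYamamoto1979, Theorem 3.2, (3.11)] -/
theorem tendsto_one_sub_pow_three_mul_tsum_lensMultiplicity_mul_pow (q : ℕ) (hq : q ≠ 0) {p₁ p₂ : ℤ}
    (hp₁ : IsCoprime p₁ q) (hp₂ : IsCoprime p₂ q) :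
    Tendsto (fun z : ℂ ↦ (1 - z) ^ 3 * ∑' k : ℕ, (lensMultiplicity q p₁ p₂ k : ℂ) * z ^ k)
      (𝓝[Metric.ball 0 1] 1) (𝓝 (2 / (q : ℂ))) := by
  have hle : 𝓝[Metric.ball (0 : ℂ) 1] (1 : ℂ) ≤ 𝓝[≠] 1 :=
    nhdsWithin_mono _ fun z hz (h1 : z = 1) ↦ by
      rw [h1, mem_ball_zero_iff, norm_one] at hz
      exact lt_irrefl _ hz
  refine ((tendsto_one_sub_pow_three_mul_lensGeneratingFunction q hq hp₁ hp₂).mono_left hle).congr' ?_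
  filter_upwards [self_mem_nhdsWithin] with z hz
  rw [tsum_lensMultiplicity_mul_pow q hq p₁ p₂ (mem_ball_zero_iff.mp hz)]

/-- **COROLLARY 3.3 (Ikeda–Yamamoto 1979) for the three-dimensional lens spaces**: "Assume `L(q : p₀, ⋯, p_n)` is isospectral
to `L(q' : p'₀, ⋯, p'_n)`. Then we have `q = q'`" — if `L(q; p₁, p₂)` and `L(q'; p₁', p₂')` (`pᵢ` prime to `q`, `pᵢ'` prime to
`q'`) have the same multiplicities `dim E_{k(k+2)}` for every `k` (Corollary 2.3: the same spectrum), then `q = q'` (the order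
of the fundamental group, equivalently the volume `2π²/q`, is heard); the printed proof: the generating functions coincide and
(3.11). [cite: IkedaYamamoto1979, Corollary 3.3] -/
theorem eq_of_lensMultiplicity_eq {q q' : ℕ} (hq : q ≠ 0) (hq' : q' ≠ 0) {p₁ p₂ p₁' p₂' : ℤ}
    (hp₁ : IsCoprime p₁ q) (hp₂ : IsCoprime p₂ q) (hp₁' : IsCoprime p₁' q') (hp₂' : IsCoprime p₂' q')
    (h : ∀ k : ℕ, lensMultiplicity q p₁ p₂ k = lensMultiplicity q' p₁' p₂' k) : q = q' := by
  have h1 := tendsto_one_sub_pow_three_mul_tsum_lensMultiplicity_mul_pow q hq hp₁ hp₂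
  have h2 := tendsto_one_sub_pow_three_mul_tsum_lensMultiplicity_mul_pow q' hq' hp₁' hp₂'
  simp only [← h] at h2
  haveI : (𝓝[Metric.ball (0 : ℂ) 1] (1 : ℂ)).NeBot := mem_closure_iff_nhdsWithin_neBot.mp (by
    rw [closure_ball (0 : ℂ) one_ne_zero, Metric.mem_closedBall, dist_zero_right, norm_one])
  have e := tendsto_nhds_unique h1 h2
  rw [div_eq_div_iff (Nat.cast_ne_zero.mpr hq) (Nat.cast_ne_zero.mpr hq')] at e
  have e2 := mul_left_cancel₀ two_ne_zero e
  exact_mod_cast e2.symm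

end Literature.Analysis.InnerProduct
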